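import Summits.CriticalPhenomena.PercolationContinuityZ3.Theorems.Transplant.KNLevelsLocality
import Literature.Probability.Percolation.KozmaNitzanBoxes
import HarnessLib

/-!
# The `ℤ^d` instance of the levels layer (REGRESSION of the generic re-typing against Kozma–Nitzan's original): the boxes `B⟨j⟩ = Icc (lo - j) (hi + j)`
# as levels, and the dictionary `KNLevels.{lattW, IsSubbox, FinSupp, LHyp}` on `zdGraph d` ↔ `KozmaNitzan.{lattW, IsSubbox, FinSupp, LHyp}`

builds on p205010 (kernel theorem, internal audit signed; external expert review pending) — nothing in this file uses p205010.
Lane `prim-bschramm`, seat `prim-bschramm-stmt` (F7 / kit-instance division with p2-g2 07:51Z: the `ℤ^d` kit is the regression test of the generic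
assembly; this file is its levels layer).  Everything here is a definitional bridge: the generic objects of p3-g2's `KNLevelsDefs.lean` /
`KNLevelsLocality.lean` specialised to `G = zdGraph d` coincide with the `ℤ^d` objects of `L/KozmaNitzanTargetLemma.lean`.

* `KNLevels.lattW_zdGraph : KNLevels.lattW (zdGraph d) p = KozmaNitzan.lattW d p`;
* `KNLevels.isSubbox_zdGraph_iff : KNLevels.IsSubbox (zdGraph d) W p D ↔ KozmaNitzan.IsSubbox W p D`, `KNLevels.finSupp_iff_zd`;
* `KNLevels.zdLevels L : KNLevels.LData (zdGraph d)` — levels `X j = Icc (L.lo - j) (L.hi + j)` of a KN level datum `L : KozmaNitzan.LData d`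
  (same source and support), with the two level axioms `zdLevels_mono`, `zdLevels_nest` (tree: `Icc_enlarge_mono`, `outerBoundary_enlarge_subset`);
* `KNLevels.lhyp_zd : KozmaNitzan.LHyp L W p D R → KNLevels.LHyp (zdLevels L) W p D R` (and the converse `lhyp_of_zd`), so every generic level
  theorem (Steps II–V of p3-g2 / p2-g2) applies verbatim to the original boxes of `ℤ^d`; the degree bound `Δ = 2d` for Step II is the tree's `Literature.Probability.Percolation.degree_zdGraph_le_two_mul` (`SiteBondCriticalPoints.lean`).
[cite: KozmaNitzan2024, §4 Lemma 10 (p. 17), p. 15 (the boxes B⟨R⟩)]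
-/

noncomputable section

namespace Summit.CriticalPhenomena.PercolationContinuityZ3.Theorems

namespace Transplant

namespace KNLevels

open Literature.Probability.Percolation Literature.Probability.LatticeModels SimpleGraph

variable {d : ℕ}

/-! ## The weighting layer on `ℤ^d` -/

/-- The generic graph weighting on `zdGraph d` is KN's lattice weighting. [cite: KozmaNitzan2024, §2.1 p. 4 (P_p)] -/
theorem lattW_zdGraph (p : unitInterval) : lattW (zdGraph d) p = KozmaNitzan.lattW d p := by
  classical
  funext e
  rw [lattW_apply, KozmaNitzan.lattW_apply]

/-- The generic subbox notion on `zdGraph d` is KN's. [cite: KozmaNitzan2024, §4 p. 17 (subbox)] -/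
theorem isSubbox_zdGraph_iff {W : Sym2 (Site d) → unitInterval} {p : unitInterval} {D : Finset (Site d)} :
    IsSubbox (zdGraph d) W p D ↔ KozmaNitzan.IsSubbox W p D := by
  constructor
  · intro h
    refine ⟨fun u hu v hv huv => ?_, h.outside⟩
    by_cases hadj : (zdGraph d).Adj u v
    · rw [if_pos hadj]; exact h.adj u hu v hv hadj
    · rw [if_neg hadj]; exact h.nadj u hu v hv huv hadj
  · intro h
    refine ⟨fun u hu v hv hadj => ?_, fun u hu v hv hne hadj => ?_, h.outside⟩
    · rw [h.inside u hu v hv hadj.ne, if_pos hadj]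
    · rw [h.inside u hu v hv hne, if_neg hadj]

/-- The generic finite-support notion on `ℤ^d` is KN's. [cite: KozmaNitzan2024, Conjecture 1 (p. 3)] -/
theorem finSupp_iff_zd {W : Sym2 (Site d) → unitInterval} {S : Finset (Site d)} : FinSupp W S ↔ KozmaNitzan.FinSupp W S :=
  ⟨fun h => ⟨h.zero⟩, fun h => ⟨h.zero⟩⟩

/-! ## The boxes `B⟨j⟩` as levels -/

/-- **The `ℤ^d` level datum** of a KN datum `L = (lo, hi, o, Sfin)`: levels `X j = B⟨j⟩ = Icc (lo - j) (hi + j)`, same source and support.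
[cite: KozmaNitzan2024, §4 p. 15 (B⟨R⟩), Lemma 10 (p. 17)] -/
def zdLevels (L : KozmaNitzan.LData d) : LData (zdGraph d) where
  X := fun j => Finset.Icc (L.lo - ((j : ℕ) : Site d)) (L.hi + ((j : ℕ) : Site d))
  o := L.o
  Sfin := L.Sfin

/-- The levels of `zdLevels L`. [folklore] -/
@[simp] theorem zdLevels_X (L : KozmaNitzan.LData d) (j : ℕ) :
    (zdLevels L).X j = Finset.Icc (L.lo - ((j : ℕ) : Site d)) (L.hi + ((j : ℕ) : Site d)) := rfl

/-- The source of `zdLevels L`. [folklore] -/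
@[simp] theorem zdLevels_o (L : KozmaNitzan.LData d) : (zdLevels L).o = L.o := rfl

/-- The support of `zdLevels L`. [folklore] -/
@[simp] theorem zdLevels_Sfin (L : KozmaNitzan.LData d) : (zdLevels L).Sfin = L.Sfin := rfl

/-- **Level axiom 1 on `ℤ^d`**: the boxes `B⟨j⟩` increase with `j` (tree `Icc_enlarge_mono`). [cite: KozmaNitzan2024, §4 p. 15] -/
theorem zdLevels_mono (L : KozmaNitzan.LData d) : Monotone (zdLevels L).X :=
  fun _ _ h => KozmaNitzan.Icc_enlarge_mono h

/-- **Level axiom 2 on `ℤ^d`**: `∂^{out} B⟨j⟩ ⊆ B⟨j+1⟩` (tree `outerBoundary_enlarge_subset`). [cite: KozmaNitzan2024, §4 p. 18] -/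
theorem zdLevels_nest (L : KozmaNitzan.LData d) (j : ℕ) : outerBoundary (zdGraph d) ((zdLevels L).X j) ⊆ (zdLevels L).X (j + 1) :=
  KozmaNitzan.outerBoundary_enlarge_subset L.lo L.hi j

/-- **KN's hypotheses give the generic level hypotheses** on `zdGraph d`. [cite: KozmaNitzan2024, §4 Lemma 10 (p. 17)] -/
theorem lhyp_zd {L : KozmaNitzan.LData d} {W : Sym2 (Site d) → unitInterval} {p : unitInterval} {D : Finset (Site d)} {R : ℕ}
    (hL : KozmaNitzan.LHyp L W p D R) : LHyp (zdLevels L) W p D R where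
  mono := zdLevels_mono L
  nest := zdLevels_nest L
  sub := isSubbox_zdGraph_iff.2 hL.sub
  fin := finSupp_iff_zd.2 hL.fin
  DS := hL.DS
  encl := hL.encl
  o_not := hL.o_not
  o_mem := hL.o_mem

/-- … and conversely. [cite: KozmaNitzan2024, §4 Lemma 10 (p. 17)] -/
theorem lhyp_of_zd {L : KozmaNitzan.LData d} {W : Sym2 (Site d) → unitInterval} {p : unitInterval} {D : Finset (Site d)} {R : ℕ}
    (hL : LHyp (zdLevels L) W p D R) : KozmaNitzan.LHyp L W p D R where
  sub := isSubbox_zdGraph_iff.1 hL.sub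
  fin := finSupp_iff_zd.1 hL.fin
  DS := hL.DS
  encl := hL.encl
  o_not := hL.o_not
  o_mem := hL.o_mem

end KNLevels

end Transplant

end Summit.CriticalPhenomena.PercolationContinuityZ3.Theorems
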